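import Summits.AtomisticToContinuum.FouriersLaw.Theorems.OddSectorIrreversibilityBoundedResponseConvergesStubPositiveConductance
import Summits.AtomisticToContinuum.FouriersLaw.Theorems.BoundedResponseConverges.Negative.OscillationExcluded

/-!
# The series-law reduction of crux `OddSectorIrreversibility.BoundedResponseConverges`
# (stmt-AtomisticToContinuum-9141) to ONE sibling crux, `FeketeSeriesLaw.QuasiSubadditiveResistance`

With positive conductance at every finite length LANDED (`Stubs.positiveConductance_holds`, stub P of line
`two-scale-gluing-log-rigidity`), the `FeketeSeriesLaw` route's two provable-now glue items close, and the
crux of this line becomes a corollary of the single open crux `QuasiSubadditiveResistance`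
(stmt-AtomisticToContinuum-14041: `R_{N+M} ≤ R_N + R_M + C`, `R_N = (N-1)/D_N`):

* `feketeGlue_holds` — **`FeketeSeriesLaw.FeketeGlue` (stmt-AtomisticToContinuum-14042) holds**: Fekete's
  lemma with an additive defect on the index semigroup `{n ≥ 2}` (`a (n+m) ≤ a n + a m + C`, `a n ≥ 0` for
  `n ≥ 2` ⇒ `a n / n` converges), reduced by `b = -(a + C)` to the landed superadditive Fekete lemma with
  bounded slopes `Theorems.boundedResponseConverges_tendsto_div_of_superadditive`;
* `transferToPositiveOrInfinite_holds` — **`FeketeSeriesLaw.TransferToPositiveOrInfinite`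
  (stmt-AtomisticToContinuum-14043) holds**: `FeketeGlue → PositiveConductance → QuasiSubadditiveResistance →
  (D_N → ℓ ∈ (0, +∞] in EReal)`: `a_N = (N-1)/D_N ≥ 0` is quasi-subadditive, `a_N/N → ℓ' ≥ 0`; if `ℓ' > 0`
  then `D_N = ((N-1)/N)/(a_N/N) → 1/ℓ'`, if `ℓ' = 0` then `D_N → +∞`;
* `positiveOrInfiniteLimit_of_quasiSubadditiveResistance` — hence `QuasiSubadditiveResistance →
  FeketeSeriesLaw.PositiveOrInfiniteLimit` (stmt-9128's statement);
* `boundedResponseConverges_of_quasiSubadditiveResistance` — **`QuasiSubadditiveResistance →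
  OddSectorIrreversibility.BoundedResponseConverges`**: a bounded sequence with an `EReal` limit `ℓ > 0`
  has a real positive limit. This is the registered reduction stub of crux 9141 of that name: after it,
  the crux waits on stmt-14041 alone.

Pure real analysis over landed theorems; no definitions, no named facts.
References: Fekete 1923 / Hammersley 1988 (subadditive lemma with defect); Bonetto–Lebowitz–Rey-Bellet 2000 §5.3.
-/

noncomputable section

open Filter Topology Set

namespace Summit.AtomisticToContinuum.FouriersLaw.Cruxes.BoundedResponseConverges.TwoScaleGluingLogRigidity.Stubs

open Summit.AtomisticToContinuum.FouriersLaw.Theses.FeketeSeriesLaw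
  (FeketeGlue TransferToPositiveOrInfinite PositiveOrInfiniteLimit QuasiSubadditiveResistance
    PositiveConductance)
open Summit.AtomisticToContinuum.FouriersLaw.Theses.OddSectorIrreversibility (BoundedResponseConverges)

/-- **`FeketeGlue` (stmt-AtomisticToContinuum-14042) holds** — Fekete's lemma with additive defect on
`{n ≥ 2}`: if `a (n+m) ≤ a n + a m + C` for `n, m ≥ 2` and `a n ≥ 0` for `n ≥ 2`, then `a n / n`
converges. Proof: `b := -(a + C)` is superadditive on `{n ≥ 2}` with slopes `b n / n ≤ |C|/2`, so
`b n / n` converges (landed superadditive Fekete lemma), and `a n / n = -(b n / n) - C/n`.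
[cite: Hammersley1988, §1] -/
theorem feketeGlue_holds : FeketeGlue := by
  intro a C hsub hpos
  set b : ℕ → ℝ := fun n => -(a n + C) with hb
  have hsup : ∀ n m : ℕ, 2 ≤ n → 2 ≤ m → b n + b m ≤ b (n + m) := by
    intro n m hn hm
    have h := hsub n m hn hm
    simp only [hb]
    linarith
  have hM : ∀ n : ℕ, 2 ≤ n → b n / n ≤ |C| / 2 := by
    intro n hn
    have hn0 : (0 : ℝ) < n := by exact_mod_cast (by omega : 0 < n)
    have hn2 : (2 : ℝ) ≤ n := by exact_mod_cast hn
    have ha := hpos n hn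
    have hC : -C ≤ |C| := neg_le_abs C
    rw [div_le_iff₀ hn0]
    simp only [hb]
    nlinarith [abs_nonneg C]
  obtain ⟨s, hs, -⟩ :=
    Summit.AtomisticToContinuum.FouriersLaw.Theorems.boundedResponseConverges_tendsto_div_of_superadditive
      hsup hM
  refine ⟨-s, ?_⟩
  have hC0 : Tendsto (fun n : ℕ => C / (n : ℝ)) atTop (𝓝 0) := tendsto_const_div_atTop_nhds_zero_nat C
  have hlim : Tendsto (fun n : ℕ => -(b n / n) - C / n) atTop (𝓝 (-s - 0)) := hs.neg.sub hC0
  rw [sub_zero] at hlim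
  refine hlim.congr' ?_
  filter_upwards [eventually_gt_atTop 0] with n hn
  have hn0 : (n : ℝ) ≠ 0 := by exact_mod_cast hn.ne'
  simp only [hb]
  field_simp
  ring

/-- **`TransferToPositiveOrInfinite` (stmt-AtomisticToContinuum-14043) holds**:
`FeketeGlue → PositiveConductance → QuasiSubadditiveResistance →` (`D_N → ℓ` in `EReal` for some
`ℓ ∈ (0, +∞]`, i.e. `PositiveOrInfiniteLimit` verbatim). With `a_N := (N-1)/D_N ≥ 0` quasi-subadditive,
Fekete gives `a_N/N → ℓ' ≥ 0`; for `N ≥ 2`, `D_N = ((N-1)/N)/(a_N/N)`; if `ℓ' > 0` the limit is the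
real `1/ℓ' > 0`, if `ℓ' = 0` then `a_N/N → 0⁺` and `D_N → +∞ = ⊤`.
[cite: BonettoLebowitzReyBellet2000, §5.3] -/
theorem transferToPositiveOrInfinite_holds : TransferToPositiveOrInfinite := by
  intro hF hP hS ω₂ lam β γ hω hl hβ hγ hU μ hμ T hT D hD
  have hpos := hP ω₂ lam β γ hω hl hβ hγ hU μ hμ T hT D hD
  obtain ⟨C, hC⟩ := hS ω₂ lam β γ hω hl hβ hγ hU μ hμ T hT D hD
  set a : ℕ → ℝ := fun n => ((n - 1 : ℕ) : ℝ) / D n with ha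
  have hsub : ∀ n m : ℕ, 2 ≤ n → 2 ≤ m → a (n + m) ≤ a n + a m + C := fun n m hn hm => by
    simp only [ha]
    exact hC n m hn hm
  have ha0 : ∀ n : ℕ, 2 ≤ n → 0 ≤ a n := fun n hn => by
    simp only [ha]
    exact div_nonneg (Nat.cast_nonneg _) (hpos n hn).le
  obtain ⟨ℓ, hℓ⟩ := hF a C hsub ha0
  -- `a n / n ≥ 0` and `> 0` for `n ≥ 2`
  have hapos : ∀ n : ℕ, 2 ≤ n → 0 < a n / n := fun n hn => by
    simp only [ha]
    have hn0 : (0 : ℝ) < n := by exact_mod_cast (by omega : 0 < n)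
    have h1 : (0 : ℝ) < ((n - 1 : ℕ) : ℝ) := by exact_mod_cast (by omega : 0 < n - 1)
    exact div_pos (div_pos h1 (hpos n hn)) hn0
  have hℓ0 : 0 ≤ ℓ :=
    ge_of_tendsto hℓ ((eventually_ge_atTop 2).mono fun n hn => (hapos n hn).le)
  -- `D n = ((n-1)/n) / (a n / n)` for `n ≥ 2`
  have hDeq : ∀ n : ℕ, 2 ≤ n → D n = ((((n - 1 : ℕ) : ℝ)) / n) / (a n / n) := fun n hn => by
    simp only [ha]
    have hn0 : (n : ℝ) ≠ 0 := by exact_mod_cast (by omega : n ≠ 0)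
    have h1 : (((n - 1 : ℕ) : ℝ)) ≠ 0 := by exact_mod_cast (by omega : n - 1 ≠ 0)
    have hD0 : D n ≠ 0 := (hpos n hn).ne'
    field_simp
  -- `(n-1)/n → 1`
  have hone : Tendsto (fun n : ℕ => (((n - 1 : ℕ) : ℝ)) / n) atTop (𝓝 1) := by
    have h : Tendsto (fun n : ℕ => (1 : ℝ) - 1 / n) atTop (𝓝 (1 - 0)) :=
      tendsto_const_nhds.sub tendsto_one_div_atTop_nhds_zero_nat
    rw [sub_zero] at h
    refine h.congr' ?_
    filter_upwards [eventually_ge_atTop 1] with n hn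
    have hn0 : (n : ℝ) ≠ 0 := by exact_mod_cast (by omega : n ≠ 0)
    rw [Nat.cast_sub hn, Nat.cast_one]
    field_simp
  rcases hℓ0.lt_or_eq with hℓpos | hℓzero
  · -- real positive limit `1/ℓ`
    refine ⟨((1 / ℓ : ℝ) : EReal), by exact_mod_cast one_div_pos.2 hℓpos, ?_⟩
    refine EReal.tendsto_coe.2 ?_
    have hlim : Tendsto (fun n : ℕ => ((((n - 1 : ℕ) : ℝ)) / n) / (a n / n)) atTop (𝓝 (1 / ℓ)) :=
      hone.div hℓ hℓpos.ne'
    refine hlim.congr' ?_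
    filter_upwards [eventually_ge_atTop 2] with n hn
    exact (hDeq n hn).symm
  · -- `ℓ = 0`: `D n → +∞`
    refine ⟨⊤, by exact_mod_cast EReal.coe_lt_top 0, ?_⟩
    refine EReal.tendsto_coe_nhds_top_iff.2 ?_
    -- `a n / n → 0` from the right, so its inverse → +∞
    have hinv : Tendsto (fun n : ℕ => (a n / n)⁻¹) atTop atTop := by
      refine tendsto_inv_nhdsGT_zero.comp ?_
      rw [← hℓzero] at hℓ
      refine tendsto_nhdsWithin_iff.2 ⟨hℓ, ?_⟩
      filter_upwards [eventually_ge_atTop 2] with n hn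
      exact hapos n hn
    have hlim : Tendsto (fun n : ℕ => ((((n - 1 : ℕ) : ℝ)) / n) * (a n / n)⁻¹) atTop atTop :=
      hone.pos_mul_atTop one_pos hinv
    refine hlim.congr' ?_
    filter_upwards [eventually_ge_atTop 2] with n hn
    rw [hDeq n hn]
    ring

/-- **`QuasiSubadditiveResistance → PositiveOrInfiniteLimit`** (stmt-14041 ⇒ stmt-9128): the series
law's import slot follows from its one open crux, positivity being landed. [folklore] -/
theorem positiveOrInfiniteLimit_of_quasiSubadditiveResistance (hS : QuasiSubadditiveResistance) :
    PositiveOrInfiniteLimit :=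
  transferToPositiveOrInfinite_holds feketeGlue_holds positiveConductance_holds hS

/-- **`QuasiSubadditiveResistance → BoundedResponseConverges`** (stmt-14041 ⇒ stmt-9141, the crux of
this line): an `EReal` limit `ℓ > 0` of a sequence bounded by `B` satisfies `ℓ ≤ B < ⊤`, so it is a real
positive limit. After this theorem the crux `OddSectorIrreversibility.BoundedResponseConverges` (and its
three definitional twins) waits on `FeketeSeriesLaw.QuasiSubadditiveResistance` alone. [folklore] -/
theorem boundedResponseConverges_of_quasiSubadditiveResistance :
    Summit.AtomisticToContinuum.FouriersLaw.Theses.FeketeSeriesLaw.QuasiSubadditiveResistance →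
      Summit.AtomisticToContinuum.FouriersLaw.Theses.OddSectorIrreversibility.BoundedResponseConverges := by
  intro hS ω₂ lam β γ hω hl hβ hγ hu μ hμ T hT D hD hB
  obtain ⟨ℓ, hℓ, hlim⟩ :=
    positiveOrInfiniteLimit_of_quasiSubadditiveResistance hS ω₂ lam β γ hω hl hβ hγ hu μ hμ T hT D hD
  obtain ⟨B, hBd⟩ := hB
  have hDle : ∀ N, D N ≤ B := fun N => le_trans (le_abs_self _) (hBd ⟨N, rfl⟩)
  have hle : ℓ ≤ (B : EReal) :=
    le_of_tendsto hlim (Eventually.of_forall fun N => EReal.coe_le_coe_iff.2 (hDle N))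
  have htop : ℓ ≠ ⊤ := ne_top_of_le_ne_top (EReal.coe_ne_top B) hle
  have hbot : ℓ ≠ ⊥ := ne_bot_of_gt hℓ
  have hcoe : ((ℓ.toReal : ℝ) : EReal) = ℓ := EReal.coe_toReal htop hbot
  refine ⟨ℓ.toReal, ?_, ?_⟩
  · have h0 : (0 : EReal) < (ℓ.toReal : EReal) := by rwa [hcoe]
    exact_mod_cast h0
  · have h2 : Tendsto (fun N => ((D N : ℝ) : EReal)) atTop (𝓝 ((ℓ.toReal : ℝ) : EReal)) := by
      rwa [hcoe]
    exact EReal.tendsto_coe.1 h2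

end Summit.AtomisticToContinuum.FouriersLaw.Cruxes.BoundedResponseConverges.TwoScaleGluingLogRigidity.Stubs

end
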